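import Mathlib
import HarnessLib

/-!
# Candidate directions in every base dimension: moment curve, quantitative pigeonhole

(Line `janus-bands`, crux `ArrangementNormalForm`, stub `stub_separateHigh` — separation in base
dimension `≥ 3`; part `Candidates`, pure linear algebra in `ℝⁿ`.)

The good-direction choice of the flats-disjoint case of `stub_separateHigh`. The candidate
directions are the rational points `cand n l = (1, l+1, (l+1)², …, (l+1)^{n-1})` of the moment
curve; any `n` of them are linearly independent (Vandermonde / a polynomial of degree `< n` with
`n` roots vanishes, `pair_cand_eq_zero`). QUANTITATIVELY (`exists_eta`): there is `η > 0`
(depending on `n` and the number `N` of candidates) such that every non-zero `w ∈ ℝⁿ` is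
`η`-orthogonal (`|⟨w, v_l⟩| < η ‖w‖`) to at most `n − 1` of the candidates `v_0, …, v_{N-1}`
(bounded-below linear maps, `LinearMap.exists_antilipschitzWith`, minimum over the `n`-subsets).
PIGEONHOLE (`exists_good_cand`, registered as `separateHigh_candidates`): given finitely many
non-zero vectors `w_p` (`p ∈ P`) and `N > (n − 1) · #P` candidates, some candidate `v_l` has
`|⟨w_p, v_l⟩| ≥ η ‖w_p‖` for all `p`. Also: the base-change matrix `dirAinv v` (identity with
last column `v`, determinant `v_{last}`) making `v` the distinguished direction, and the
quantitative independence of two non-proportional rational vectors (`exists_kappa`).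
-/

noncomputable section

open Finset

namespace Summit.KontsevichZagierPeriods.ArrangementNormalForm.JanusBands

namespace SepHigh

/-- Candidate directions on the rational moment curve: `cand n l i = (l + 1)^i`. -/
def cand (n l : ℕ) : Fin n → ℚ := fun i => ((l : ℚ) + 1) ^ (i : ℕ)

/-- The real pairing `⟨w, v⟩ = ∑ᵢ wᵢ vᵢ` of a real vector with a rational one. -/
def pair {n : ℕ} (w : Fin n → ℝ) (v : Fin n → ℚ) : ℝ := ∑ i, w i * (v i : ℝ)

/-- `pair` is additive in the real argument. [folklore] -/
theorem pair_add {n : ℕ} (w w' : Fin n → ℝ) (v : Fin n → ℚ) :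
    pair (w + w') v = pair w v + pair w' v := by
  simp [pair, add_mul, sum_add_distrib]

/-- `pair` is homogeneous in the real argument. [folklore] -/
theorem pair_smul {n : ℕ} (c : ℝ) (w : Fin n → ℝ) (v : Fin n → ℚ) :
    pair (c • w) v = c * pair w v := by
  simp [pair, mul_sum, mul_assoc]

/-- `pair` is bounded by the sup norms: `|⟨w, v⟩| ≤ (∑ᵢ |vᵢ|) ‖w‖`. [folklore] -/
theorem abs_pair_le {n : ℕ} (w : Fin n → ℝ) (v : Fin n → ℚ) :
    |pair w v| ≤ (∑ i, |(v i : ℝ)|) * ‖w‖ := by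
  unfold pair
  rw [sum_mul]
  refine (abs_sum_le_sum_abs _ _).trans (sum_le_sum fun i _ => ?_)
  rw [abs_mul, mul_comm]
  exact mul_le_mul_of_nonneg_left (by simpa [Real.norm_eq_abs] using norm_le_pi_norm w i)
    (abs_nonneg _)

/-- The pairing with a moment-curve candidate is a polynomial value:
`⟨w, cand n l⟩ = (∑ᵢ wᵢ Xⁱ)(l + 1)`. [folklore] -/
theorem pair_cand_eq_eval {n : ℕ} (w : Fin n → ℝ) (l : ℕ) :
    pair w (cand n l) = (∑ i : Fin n, Polynomial.C (w i) * Polynomial.X ^ (i : ℕ)).eval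
      ((l : ℝ) + 1) := by
  simp [pair, cand, Polynomial.eval_finsetSum]

/-- **Any `n` candidates are linearly independent**: a real vector pairing to zero with `n`
distinct moment-curve candidates vanishes (a polynomial of degree `< n` with `n` roots).
[folklore] -/
theorem pair_cand_eq_zero {n : ℕ} (S : Finset ℕ) (hS : S.card = n) (w : Fin n → ℝ)
    (h : ∀ l ∈ S, pair w (cand n l) = 0) : w = 0 := by
  rcases Nat.eq_zero_or_pos n with rfl | hn
  · exact funext fun i => i.elim0
  set f : Polynomial ℝ := ∑ i : Fin n, Polynomial.C (w i) * Polynomial.X ^ (i : ℕ) with hf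
  have hdeg : f.natDegree ≤ n - 1 :=
    Polynomial.natDegree_sum_le_of_forall_le _ _ fun i _ =>
      (Polynomial.natDegree_C_mul_X_pow_le _ _).trans (by omega)
  have hf0 : f = 0 := by
    refine Polynomial.eq_zero_of_natDegree_lt_card_of_eval_eq_zero f
      (f := fun l : S => ((l : ℕ) : ℝ) + 1) (fun l l' hll' => ?_) (fun l => ?_) ?_
    · have : ((l : ℕ) : ℝ) = ((l' : ℕ) : ℝ) := by simpa using hll'
      exact Subtype.ext (by exact_mod_cast this)
    · rw [hf, ← pair_cand_eq_eval]
      exact h l l.2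
    · rw [Fintype.card_coe, hS]
      omega
  funext i
  have hc : f.coeff (i : ℕ) = w i := by
    rw [hf, Polynomial.finsetSum_coeff]
    simp only [Polynomial.coeff_C_mul_X_pow]
    rw [Finset.sum_eq_single i (fun j _ hji => if_neg fun h => hji (Fin.ext h).symm)
      (fun hi => absurd (Finset.mem_univ i) hi), if_pos rfl]
  rw [← hc, hf0, Polynomial.coeff_zero, Pi.zero_apply]

/-- The linear map `w ↦ (⟨w, cand n l⟩)_{l ∈ S}`. -/
def pairMap (n : ℕ) (S : Finset ℕ) : (Fin n → ℝ) →ₗ[ℝ] (S → ℝ) where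
  toFun w l := pair w (cand n l)
  map_add' w w' := funext fun _ => pair_add w w' _
  map_smul' c w := funext fun _ => pair_smul c w _

/-- For an `n`-subset `S` of candidates, some `η_S > 0` makes it impossible for a non-zero vector
to be `η_S`-orthogonal to all of `S`. [folklore] -/
theorem exists_eta_subset {n : ℕ} (S : Finset ℕ) (hS : S.card = n) :
    ∃ η : ℝ, 0 < η ∧ ∀ w : Fin n → ℝ, w ≠ 0 → ¬ ∀ l ∈ S, |pair w (cand n l)| < η * ‖w‖ := by
  have hker : LinearMap.ker (pairMap n S) = ⊥ :=
    LinearMap.ker_eq_bot'.2 fun w hw => pair_cand_eq_zero S hS w fun l hl => by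
      simpa [pairMap] using congr_fun hw ⟨l, hl⟩
  obtain ⟨K, hK, hanti⟩ := (pairMap n S).exists_antilipschitzWith hker
  refine ⟨(K : ℝ)⁻¹, by positivity, fun w hw hlt => ?_⟩
  have hwpos : 0 < ‖w‖ := norm_pos_iff.2 hw
  have h1 : ‖w‖ ≤ K * ‖pairMap n S w‖ := by
    have := hanti.le_mul_dist w 0
    simpa [dist_eq_norm] using this
  have h2 : ‖pairMap n S w‖ < (K : ℝ)⁻¹ * ‖w‖ := by
    rw [pi_norm_lt_iff (by positivity)]
    exact fun l => by simpa [pairMap, Real.norm_eq_abs] using hlt l l.2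
  have hK' : (0 : ℝ) < K := by exact_mod_cast hK
  have h3 : (K : ℝ) * ‖pairMap n S w‖ < ‖w‖ := by
    calc (K : ℝ) * ‖pairMap n S w‖ < K * ((K : ℝ)⁻¹ * ‖w‖) := mul_lt_mul_of_pos_left h2 hK'
      _ = ‖w‖ := by field_simp
  exact absurd (h1.trans_lt h3) (lt_irrefl _)

/-- A finite family of positive thresholds for antitone properties has a common positive
threshold. [folklore] -/
theorem exists_pos_forall {ι : Type*} (I : Finset ι) (Q : ι → ℝ → Prop)
    (hQ : ∀ i ∈ I, ∀ η η', Q i η → 0 < η' → η' ≤ η → Q i η')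
    (h : ∀ i ∈ I, ∃ η : ℝ, 0 < η ∧ Q i η) : ∃ η : ℝ, 0 < η ∧ ∀ i ∈ I, Q i η := by
  classical
  induction I using Finset.induction_on with
  | empty => exact ⟨1, one_pos, fun i hi => absurd hi (Finset.notMem_empty i)⟩
  | insert i₀ I hi₀ ih =>
    obtain ⟨η₁, hη₁, h₁⟩ := h i₀ (mem_insert_self i₀ I)
    obtain ⟨η₂, hη₂, h₂⟩ := ih (fun i hi => hQ i (mem_insert_of_mem hi))
      (fun i hi => h i (mem_insert_of_mem hi))
    refine ⟨min η₁ η₂, lt_min hη₁ hη₂, fun i hi => ?_⟩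
    rcases Finset.mem_insert.1 hi with rfl | hi
    · exact hQ _ (mem_insert_self _ I) η₁ _ h₁ (lt_min hη₁ hη₂) (min_le_left _ _)
    · exact hQ i (mem_insert_of_mem hi) η₂ _ (h₂ i hi) (lt_min hη₁ hη₂) (min_le_right _ _)

/-- **Quantitative independence of the candidates**: some `η > 0` (depending on `n`, `N`) such
that every non-zero `w ∈ ℝⁿ` is `η`-orthogonal to at most `n − 1` of the candidates
`cand n 0, …, cand n (N − 1)`. [folklore] -/
theorem exists_eta (n N : ℕ) : ∃ η : ℝ, 0 < η ∧ ∀ w : Fin n → ℝ, w ≠ 0 →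
    ((Finset.range N).filter fun l => |pair w (cand n l)| < η * ‖w‖).card ≤ n - 1 := by
  obtain ⟨η, hη, hall⟩ := exists_pos_forall ((Finset.range N).powersetCard n)
    (fun S η => ∀ w : Fin n → ℝ, w ≠ 0 → ¬ ∀ l ∈ S, |pair w (cand n l)| < η * ‖w‖)
    (fun S _ η η' hS hη' hle w hw hlt => hS w hw fun l hl =>
      (hlt l hl).trans_le (mul_le_mul_of_nonneg_right hle (norm_nonneg _)))
    (fun S hS => exists_eta_subset S (Finset.mem_powersetCard.1 hS).2)
  refine ⟨η, hη, fun w hw => ?_⟩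
  by_contra hlt
  have hle : n ≤ ((Finset.range N).filter fun l => |pair w (cand n l)| < η * ‖w‖).card := by
    omega
  obtain ⟨S, hSsub, hScard⟩ := Finset.exists_subset_card_eq hle
  have hSmem : S ∈ (Finset.range N).powersetCard n :=
    Finset.mem_powersetCard.2 ⟨hSsub.trans (Finset.filter_subset _ _), hScard⟩
  exact hall S hSmem w hw fun l hl => (Finset.mem_filter.1 (hSsub hl)).2

/-- **Pigeonhole**: finitely many non-zero vectors `w_p` and `N > (n − 1) · #P` candidates ⟹ some
candidate pairs `η`-substantially with every `w_p`. [folklore] -/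
theorem exists_good_cand {n N : ℕ} {η : ℝ}
    (hη : ∀ w : Fin n → ℝ, w ≠ 0 →
      ((Finset.range N).filter fun l => |pair w (cand n l)| < η * ‖w‖).card ≤ n - 1)
    {ι : Type*} (P : Finset ι) (w : ι → Fin n → ℝ) (hw : ∀ p ∈ P, w p ≠ 0)
    (hN : (n - 1) * P.card < N) :
    ∃ l < N, ∀ p ∈ P, η * ‖w p‖ ≤ |pair (w p) (cand n l)| := by
  classical
  set Bad : Finset ℕ := P.biUnion fun p => (Finset.range N).filter
    fun l => |pair (w p) (cand n l)| < η * ‖w p‖ with hBad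
  have hsub : Bad ⊆ Finset.range N := Finset.biUnion_subset.2 fun p _ => Finset.filter_subset _ _
  have hcard : Bad.card ≤ (n - 1) * P.card := by
    refine (Finset.card_biUnion_le).trans ?_
    rw [mul_comm]
    exact Finset.sum_le_card_nsmul _ _ _ fun p hp => hη (w p) (hw p hp)
  have hne : (Finset.range N \ Bad).Nonempty := by
    rw [← Finset.card_pos, Finset.card_sdiff_of_subset hsub, Finset.card_range]
    omega
  obtain ⟨l, hl⟩ := hne
  rw [Finset.mem_sdiff, Finset.mem_range] at hl
  refine ⟨l, hl.1, fun p hp => ?_⟩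
  by_contra hlt
  exact hl.2 (Finset.mem_biUnion.2 ⟨p, hp, Finset.mem_filter.2 ⟨Finset.mem_range.2 hl.1,
    not_le.1 hlt⟩⟩)

/-- The sup norm of a candidate is at most `N^{n}` … concretely `|cand n l i| ≤ (l + 1)^(n-1)`;
we use the cruder `∑ᵢ |cand n l i| ≤ n · N ^ n` for `l < N`. [folklore] -/
theorem sum_abs_cand_le {n N l : ℕ} (hl : l < N) :
    (∑ i : Fin n, |((cand n l i : ℚ) : ℝ)|) ≤ n * (N : ℝ) ^ n := by
  have hN1 : (1 : ℝ) ≤ N := by exact_mod_cast Nat.succ_le_of_lt (Nat.zero_lt_of_lt hl)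
  have hlN : (l : ℝ) + 1 ≤ N := by exact_mod_cast Nat.succ_le_of_lt hl
  have h1 : ∀ i : Fin n, |((cand n l i : ℚ) : ℝ)| ≤ (N : ℝ) ^ n := fun i => by
    simp only [cand, Rat.cast_pow, Rat.cast_add, Rat.cast_natCast, Rat.cast_one]
    rw [abs_of_nonneg (by positivity)]
    calc ((l : ℝ) + 1) ^ (i : ℕ) ≤ (N : ℝ) ^ (i : ℕ) := pow_le_pow_left₀ (by positivity) hlN _
      _ ≤ (N : ℝ) ^ n := pow_le_pow_right₀ hN1 i.isLt.le
  calc (∑ i : Fin n, |((cand n l i : ℚ) : ℝ)|) ≤ ∑ _i : Fin n, (N : ℝ) ^ n :=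
        Finset.sum_le_sum fun i _ => h1 i
    _ = n * (N : ℝ) ^ n := by simp

/-! ### The base change making a candidate the distinguished direction -/

/-- The matrix `A⁻¹` with columns `e₀, …, e_{n-1}, v`: the substitution `x = A⁻¹ x̃` moves the
last new coordinate along `v`. -/
def dirAinv {n : ℕ} (v : Fin (n + 1) → ℚ) : Matrix (Fin (n + 1)) (Fin (n + 1)) ℚ :=
  fun i j => if j = Fin.last n then v i else (1 : Matrix (Fin (n + 1)) (Fin (n + 1)) ℚ) i j

/-- `det (dirAinv v) = v_{last}` (upper triangular). [folklore] -/
theorem det_dirAinv {n : ℕ} (v : Fin (n + 1) → ℚ) : (dirAinv v).det = v (Fin.last n) := by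
  have htri : (dirAinv v).BlockTriangular id := by
    intro i j hij
    have hj : j ≠ Fin.last n := fun h => by
      rw [h] at hij
      exact absurd (Fin.le_last i) (not_le.2 hij)
    have hne : i ≠ j := fun h => by
      rw [h] at hij
      exact lt_irrefl _ hij
    simp [dirAinv, hj, hne]
  rw [Matrix.det_of_upperTriangular htri, Fin.prod_univ_castSucc]
  simp [dirAinv, Fin.castSucc_ne_last]

/-- `∂_v` of a form: `(vecMul ℓ (dirAinv v))_{last} = ∑ᵢ ℓᵢ vᵢ`. [folklore] -/
theorem vecMul_dirAinv_last {n : ℕ} (ℓ v : Fin (n + 1) → ℚ) :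
    Matrix.vecMul ℓ (dirAinv v) (Fin.last n) = ∑ i, ℓ i * v i := by
  simp [Matrix.vecMul, dotProduct, dirAinv]

/-- `dirAinv v` is invertible when `v_{last} ≠ 0`. [folklore] -/
theorem dirAinv_mul_inv {n : ℕ} (v : Fin (n + 1) → ℚ) (hv : v (Fin.last n) ≠ 0) :
    dirAinv v * (dirAinv v)⁻¹ = 1 ∧ (dirAinv v)⁻¹ * dirAinv v = 1 := by
  have hu : IsUnit (dirAinv v).det := by
    rw [det_dirAinv]
    exact isUnit_iff_ne_zero.2 hv
  exact ⟨Matrix.mul_nonsing_inv _ hu, Matrix.nonsing_inv_mul _ hu⟩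

/-- The last coordinate of a candidate is non-zero. [folklore] -/
theorem cand_last_ne_zero (n l : ℕ) : cand (n + 1) l (Fin.last n) ≠ 0 := by
  simp only [cand]
  exact pow_ne_zero _ (by positivity)

/-! ### Quantitative independence of two non-proportional rational vectors -/

/-- Two rational vectors without a non-trivial rational linear relation have a non-vanishing
`2 × 2` minor. [folklore] -/
theorem exists_minor_ne_zero {n : ℕ} (ℓ ℓ' : Fin n → ℚ)
    (hind : ∀ μ ν : ℚ, μ • ℓ + ν • ℓ' = 0 → μ = 0 ∧ ν = 0) :
    ∃ i₁ i₂, ℓ i₁ * ℓ' i₂ - ℓ i₂ * ℓ' i₁ ≠ 0 := by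
  by_contra hall
  push Not at hall
  have hℓ : ℓ ≠ 0 := fun h => by
    have := (hind 1 0 (by simp [h])).1
    exact one_ne_zero this
  obtain ⟨i₁, hi₁⟩ := Function.ne_iff.1 hℓ
  have key : ℓ' i₁ • ℓ + (-ℓ i₁) • ℓ' = 0 := by
    funext i
    have h := hall i₁ i
    simp only [Pi.add_apply, Pi.smul_apply, smul_eq_mul, Pi.zero_apply]
    linear_combination -h
  exact hi₁ (neg_eq_zero.1 (hind _ _ key).2)

/-- **Quantitative independence**: for two rational vectors `ℓ, ℓ'` without a non-trivial
rational relation there is `κ > 0` with `‖u' ℓ − u ℓ'‖ ≥ κ (|u| + |u'|)` for all real `u, u'`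
(the real vector `u' ℓ − u ℓ'` in the sup norm). [folklore] -/
theorem exists_kappa {n : ℕ} (ℓ ℓ' : Fin n → ℚ)
    (hind : ∀ μ ν : ℚ, μ • ℓ + ν • ℓ' = 0 → μ = 0 ∧ ν = 0) :
    ∃ κ : ℝ, 0 < κ ∧ ∀ u u' : ℝ,
      κ * (|u| + |u'|) ≤ ‖fun i => u' * (ℓ i : ℝ) - u * (ℓ' i : ℝ)‖ := by
  obtain ⟨i₁, i₂, hm⟩ := exists_minor_ne_zero ℓ ℓ' hind
  -- the linear map `(u, u') ↦ u' ℓ − u ℓ'` on `ℝ²` is injective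
  set T : (Fin 2 → ℝ) →ₗ[ℝ] (Fin n → ℝ) :=
    { toFun := fun q i => q 1 * (ℓ i : ℝ) - q 0 * (ℓ' i : ℝ)
      map_add' := fun q q' => funext fun i => by simp only [Pi.add_apply]; ring
      map_smul' := fun c q => funext fun i => by
        simp only [Pi.smul_apply, smul_eq_mul, RingHom.id_apply]; ring } with hT
  have hker : LinearMap.ker T = ⊥ := by
    refine LinearMap.ker_eq_bot'.2 fun q hq => ?_
    have h1 : q 1 * (ℓ i₁ : ℝ) - q 0 * (ℓ' i₁ : ℝ) = 0 := congr_fun hq i₁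
    have h2 : q 1 * (ℓ i₂ : ℝ) - q 0 * (ℓ' i₂ : ℝ) = 0 := congr_fun hq i₂
    have hm' : (ℓ i₁ : ℝ) * (ℓ' i₂ : ℝ) - (ℓ i₂ : ℝ) * (ℓ' i₁ : ℝ) ≠ 0 := by exact_mod_cast hm
    have hq0 : q 0 = 0 := by
      have : q 0 * ((ℓ i₁ : ℝ) * (ℓ' i₂ : ℝ) - (ℓ i₂ : ℝ) * (ℓ' i₁ : ℝ)) = 0 := by
        linear_combination (ℓ i₂ : ℝ) * h1 - (ℓ i₁ : ℝ) * h2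
      exact (mul_eq_zero.1 this).resolve_right hm'
    have hq1 : q 1 = 0 := by
      have : q 1 * ((ℓ i₁ : ℝ) * (ℓ' i₂ : ℝ) - (ℓ i₂ : ℝ) * (ℓ' i₁ : ℝ)) = 0 := by
        linear_combination (ℓ' i₂ : ℝ) * h1 - (ℓ' i₁ : ℝ) * h2
      exact (mul_eq_zero.1 this).resolve_right hm'
    funext i
    fin_cases i
    · exact hq0
    · exact hq1
  obtain ⟨K, hK, hanti⟩ := T.exists_antilipschitzWith hker
  have hK' : (0 : ℝ) < K := by exact_mod_cast hK
  refine ⟨((K : ℝ) * 2)⁻¹, by positivity, fun u u' => ?_⟩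
  have h1 : ‖(![u, u'] : Fin 2 → ℝ)‖ ≤ K * ‖T ![u, u']‖ := by
    have := hanti.le_mul_dist ![u, u'] 0
    simpa [dist_eq_norm] using this
  have h2 : |u| + |u'| ≤ 2 * ‖(![u, u'] : Fin 2 → ℝ)‖ := by
    have hu : |u| ≤ ‖(![u, u'] : Fin 2 → ℝ)‖ := by
      simpa [Real.norm_eq_abs] using norm_le_pi_norm (![u, u'] : Fin 2 → ℝ) 0
    have hu' : |u'| ≤ ‖(![u, u'] : Fin 2 → ℝ)‖ := by
      simpa [Real.norm_eq_abs] using norm_le_pi_norm (![u, u'] : Fin 2 → ℝ) 1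
    linarith
  have hTq : T ![u, u'] = fun i => u' * (ℓ i : ℝ) - u * (ℓ' i : ℝ) := by
    funext i
    simp [hT]
  rw [← hTq]
  calc ((K : ℝ) * 2)⁻¹ * (|u| + |u'|) ≤ ((K : ℝ) * 2)⁻¹ * (2 * (K * ‖T ![u, u']‖)) := by
        gcongr
        exact h2.trans (by linarith)
    _ = ‖T ![u, u']‖ := by field_simp

end SepHigh

open SepHigh in
/-- **Pigeonhole choice of a good candidate direction in `ℝⁿ`** (registered part of
`stub_separateHigh`): with `η` as in `SepHigh.exists_eta`, finitely many non-zero vectors `w_p`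
and `N > (n − 1) · #P` moment-curve candidates, some candidate `v_l` has
`|⟨w_p, v_l⟩| ≥ η ‖w_p‖` for every `p`. [folklore] -/
theorem separateHigh_candidates (n N : ℕ) (η : ℝ) (hη : ∀ w : Fin n → ℝ, w ≠ 0 → ((Finset.range N).filter fun l => |SepHigh.pair w (SepHigh.cand n l)| < η * ‖w‖).card ≤ n - 1) (ι : Type) (P : Finset ι) (w : ι → Fin n → ℝ) (hw : ∀ p ∈ P, w p ≠ 0) (hN : (n - 1) * P.card < N) : ∃ l < N, ∀ p ∈ P, η * ‖w p‖ ≤ |SepHigh.pair (w p) (SepHigh.cand n l)| :=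
  exists_good_cand hη P w hw hN

end Summit.KontsevichZagierPeriods.ArrangementNormalForm.JanusBands
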